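import Summits.ResolutionOfSingularities.ResolutionOfSingularities.Theorems.EquisingularLiftEquisingularLiftNatNoseResidueTopLocus
import Summits.ResolutionOfSingularities.ResolutionOfSingularities.Theorems.EquisingularLiftEquisingularLiftNatFatTouchNotFinishing
import Literature.AlgebraicGeometry.Resolution.BlowupDisjointCentreSplitting
import Literature.AlgebraicGeometry.Resolution.MarkedIdealsLemmas
import HarnessLib

/-!
# [OURS · L1 W4.5(b) · EL♮(3)] NOSE RESIDUE STRUCTURE, brick 5 — the singular locus of a residue `H` is a FINITE union of closed irreducible pieces
# (its «singular curves» are finitely many), and the curve clause of the nose engines is LOCAL (it passes to disjoint unions)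

Cell `res-hironaka`, rung L, slot W4.5(b), D-0157 DOOR 1 width seat `res-L1-w45b-nose-w4` (desk WIDTH TABLE D1 row nose-w4, desk word (ii));
crux CHILD EL♮(3) = stmt-ResolutionOfSingularities-20148 (parent EL♮ stmt-…-20038). OURS; NOT a statement of any manuscript; nothing of
[Hironaka2017] is asserted or used; AI kernel work, weaker than expert review. Resolution of singularities in positive characteristic is NOT proved here
(dimension 3 is a theorem in print, Cossart–Piltant 2008/2009). No `sorry`, no new definition, no instance, no notation; standard axioms.
`--kind proof --supports stmt-ResolutionOfSingularities-20148 --as helper`.  Sister files: `…NatNoseResidueUnfold` (1a), `…Core` (1b), `…TopLocus` (2),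
`…ClassTwoRegular` (3), `…Profile` (4).

* §1 `singularLocus_finite_decomposition` — for `ι : H ↪ ℙⁿ_k` a closed immersion of an integral scheme, the image `ι(Sing H)` of the non-regular locus is a
  FINITE union `⋃₀ 𝒞` of closed irreducible sets `C ⊆ ι(Sing H)`, each with `ι(H) ⊄ C` (the irreducible components of the Noetherian closed `Sing H`, pushed
  forward).  So «for every singular curve of `H`» (bricks 2–4) is a finite quantification, and `Sing H` infinite ⇔ some `C ∈ 𝒞` is infinite.
* §2 `ringKrullDim_stalk_redSub_union_of_disjoint` — LOCALITY of the curve clause: if `Z₁, Z₂` are disjoint closed subsets of any scheme `X` and the reduced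
  subschemes `Z̃₁`, `Z̃₂` both have `dim 𝒪 = d` at their closed points, then so does the reduced subscheme of `Z₁ ∪ Z₂` (its stalk at a point over `Z₁` is
  `𝒪_{X,x} ⧸ 𝓘(Z₁)_x` since `𝓘(Z₁ ∪ Z₂) = 𝓘(Z₁)·𝓘(Z₂)` and `𝓘(Z₂)_x = ⊤` off `Z₂`).  With brick 2's `ringKrullDim_stalk_redSub_eq_one` this gives the curve
  clause of `ReachNoseTower₇/B/B′/B″/B‴` for disjoint unions of curves on a surface `H ⊂ ℙ³_k` (res-L1-w45b-nose-w3's NOSE-CERT-CENSUS §2 gap (a), e.g. two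
  skew double lines): `ringKrullDim_stalk_redSub_union_eq_one_three`.
-/

set_option linter.dupNamespace false

noncomputable section

open CategoryTheory CategoryTheory.Limits AlgebraicGeometry TopologicalSpace Topology IsLocalRing
open Literature.AlgebraicGeometry.Resolution
open Literature.AlgebraicGeometry.Motives
open AlgebraicGeometry.Scheme.IdealSheafData
open Summit.ResolutionOfSingularities.ResolutionOfSingularities.Cruxes.EquisingularLift.StrataSplit

namespace Summit.ResolutionOfSingularities.ResolutionOfSingularities.Cruxes.EquisingularLiftNat.Sections

/-! ## §1 The singular locus of `H` has finitely many irreducible pieces -/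

/-- In a Noetherian topological space a closed set is the union of FINITELY many closed irreducible subsets (the images of the irreducible components
of the subspace). [folklore] -/
theorem exists_finite_sUnion_isIrreducible_of_isClosed {X : Type*} [TopologicalSpace X] [NoetherianSpace X]
    {S : Set X} (hS : IsClosed S) :
    ∃ 𝒞 : Set (Set X), 𝒞.Finite ∧ (∀ C ∈ 𝒞, IsClosed C ∧ IsIrreducible C ∧ C ⊆ S) ∧ ⋃₀ 𝒞 = S := by
  have hfin : (irreducibleComponents S).Finite := NoetherianSpace.finite_irreducibleComponents
  refine ⟨(fun C : Set S => Subtype.val '' C) '' irreducibleComponents S, hfin.image _, ?_, ?_⟩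
  · rintro _ ⟨C, hC, rfl⟩
    exact ⟨hS.isClosedEmbedding_subtypeVal.isClosedMap C (isClosed_of_mem_irreducibleComponents C hC),
      hC.1.image _ continuous_subtype_val.continuousOn, Subtype.coe_image_subset S C⟩
  · apply Set.Subset.antisymm
    · rintro x ⟨_, ⟨C, -, rfl⟩, hx⟩
      exact Subtype.coe_image_subset S C hx
    · intro x hx
      exact ⟨Subtype.val '' irreducibleComponent (⟨x, hx⟩ : S), ⟨_, irreducibleComponent_mem_irreducibleComponents _, rfl⟩,
        ⟨⟨x, hx⟩, mem_irreducibleComponent, rfl⟩⟩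

/-- **The singular locus of `H ↪ ℙⁿ_k` is a FINITE union of closed irreducible pieces.** For a closed immersion `ι : H ↪ ℙⁿ_k` (`k` a field) of an
integral scheme, `ι(Sing H) = ⋃₀ 𝒞` for a finite family `𝒞` of closed irreducible `C ⊆ ι(Sing H)` with `ι(H) ⊄ C` (the generic point of `H` is regular).
The infinite members of `𝒞` are the «singular curves» of bricks 2–4 (at `n = 3` each is one-dimensional, `topologicalKrullDim_eq_one_of_three`).
[folklore] -/
theorem singularLocus_finite_decomposition (k : Type) [Field k] (n : ℕ) (H : Scheme.{0}) (ι : H ⟶ (projectiveSpace n k).left)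
    [IsClosedImmersion ι] [IsIntegral H] :
    ∃ 𝒞 : Set (Set (projectiveSpace n k).left), 𝒞.Finite ∧
      (∀ C ∈ 𝒞, IsClosed C ∧ IsIrreducible C ∧ C ⊆ ι '' {x : H | ¬ IsRegularLocalRing (H.presheaf.stalk x)} ∧
        C ⊆ Set.range ι ∧ ¬ (Set.range ι ⊆ C)) ∧
      ⋃₀ 𝒞 = ι '' {x : H | ¬ IsRegularLocalRing (H.presheaf.stalk x)} := by
  obtain ⟨hN, hqe⟩ := isNoetherian_and_isQuasiExcellent_of_isClosedImmersion_projectiveSpace n ι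
  haveI := hN
  have hSc : IsClosed {x : H | ¬ IsRegularLocalRing (H.presheaf.stalk x)} :=
    (Scheme.isOpen_regularLocus_of_isQuasiExcellent hqe).isClosed_compl
  obtain ⟨𝒞₀, hfin, hprop, hU⟩ := exists_finite_sUnion_isIrreducible_of_isClosed hSc
  refine ⟨(fun C => ι '' C) '' 𝒞₀, hfin.image _, ?_, ?_⟩
  · rintro _ ⟨C, hC, rfl⟩
    obtain ⟨hCc, hCirr, hCS⟩ := hprop C hC
    refine ⟨ι.isClosedEmbedding.isClosedMap C hCc, hCirr.image _ ι.continuous.continuousOn, Set.image_mono hCS,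
      Set.image_subset_range _ _, fun hsub => ?_⟩
    obtain ⟨x, hxC, hx⟩ := hsub (Set.mem_range_self (genericPoint H))
    have hxg : x = genericPoint H := ι.isClosedEmbedding.injective hx
    subst hxg
    exact hCS hxC (genericPoint_mem_regularLocus H)
  · rw [Set.sUnion_image, ← Set.image_iUnion₂, ← Set.sUnion_eq_biUnion, hU]

/-! ## §2 The curve clause is local: disjoint unions -/

/-- The stalk dimension of a reduced closed subscheme `V(𝓘_Z)` at a point `z` equals `dim (𝒪_{X,x} ⧸ 𝓘(Z)_x)` at `x = ι z`. [folklore] -/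
theorem ringKrullDim_stalk_redSub_eq_quotient {X : Scheme.{0}} (Z : Set X) (hZ : IsClosed Z) (z : ↥(redSub X Z hZ)) :
    ringKrullDim ((redSub X Z hZ).presheaf.stalk z) =
      ringKrullDim (X.presheaf.stalk (redSubι X Z hZ z) ⧸ stalkIdeal (vanishingIdeal (⟨Z, hZ⟩ : Closeds X)) (redSubι X Z hZ z)) := by
  rw [← ker_stalkMap_subschemeι_eq_stalkIdeal, ringKrullDim_quotient_ker_stalkMap]

/-- A point of `V(𝓘_Z)` over a point `x ∈ Z` whose singleton is closed in `X` is a closed point of `V(𝓘_Z)`. [folklore] -/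
theorem isClosed_singleton_redSub_of_isClosed {X : Scheme.{0}} (Z : Set X) (hZ : IsClosed Z) (z : ↥(redSub X Z hZ))
    (hx : IsClosed ({redSubι X Z hZ z} : Set X)) : IsClosed ({z} : Set ↥(redSub X Z hZ)) := by
  have hpre : (redSubι X Z hZ : ↥(redSub X Z hZ) → X) ⁻¹' {redSubι X Z hZ z} = {z} := by
    ext w
    simp only [Set.mem_preimage, Set.mem_singleton_iff]
    exact ⟨fun h => (redSubι X Z hZ).isClosedEmbedding.injective h, fun h => by rw [h]⟩
  rw [← hpre]
  exact hx.preimage (redSubι X Z hZ).continuous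

/-- The image in `X` of a closed point of `V(𝓘_Z)` is a closed point of `X`. [folklore] -/
theorem isClosed_singleton_of_isClosed_redSub {X : Scheme.{0}} (Z : Set X) (hZ : IsClosed Z) (z : ↥(redSub X Z hZ))
    (hz : IsClosed ({z} : Set ↥(redSub X Z hZ))) : IsClosed ({redSubι X Z hZ z} : Set X) := by
  have h := (redSubι X Z hZ).isClosedEmbedding.isClosedMap _ hz
  rwa [Set.image_singleton] at h

/-- **LOCALITY OF THE CURVE CLAUSE.** If `Z₁, Z₂ ⊆ X` are disjoint closed sets whose reduced subschemes have `dim 𝒪 = d` at all closed points, then the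
reduced subscheme of `Z₁ ∪ Z₂` has `dim 𝒪 = d` at all closed points: `𝓘(Z₁ ∪ Z₂) = 𝓘(Z₁)·𝓘(Z₂)` (`vanishingIdeal_sup_eq_mul_of_disjoint`) and off `Z₂` the
factor `𝓘(Z₂)_x` is the unit ideal, so the stalk over `x ∈ Z₁` is `𝒪_{X,x} ⧸ 𝓘(Z₁)_x`, the stalk of `Z̃₁`. [folklore] -/
theorem ringKrullDim_stalk_redSub_union_of_disjoint {X : Scheme.{0}} {Z₁ Z₂ : Set X} (h₁ : IsClosed Z₁) (h₂ : IsClosed Z₂)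
    (hdisj : Z₁ ∩ Z₂ = ∅) (h₁₂ : IsClosed (Z₁ ∪ Z₂)) {d : WithBot ℕ∞}
    (hd₁ : ∀ z : ↥(redSub X Z₁ h₁), IsClosed ({z} : Set ↥(redSub X Z₁ h₁)) → ringKrullDim ((redSub X Z₁ h₁).presheaf.stalk z) = d)
    (hd₂ : ∀ z : ↥(redSub X Z₂ h₂), IsClosed ({z} : Set ↥(redSub X Z₂ h₂)) → ringKrullDim ((redSub X Z₂ h₂).presheaf.stalk z) = d) :
    ∀ z : ↥(redSub X (Z₁ ∪ Z₂) h₁₂), IsClosed ({z} : Set ↥(redSub X (Z₁ ∪ Z₂) h₁₂)) →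
      ringKrullDim ((redSub X (Z₁ ∪ Z₂) h₁₂).presheaf.stalk z) = d := by
  intro z hz
  have hd : Disjoint Z₁ Z₂ := Set.disjoint_iff_inter_eq_empty.mpr hdisj
  -- the point `x` under `z`, closed in `X`, lies in `Z₁ ∪ Z₂`
  set x : X := redSubι X (Z₁ ∪ Z₂) h₁₂ z with hxdef
  have hxcl : IsClosed ({x} : Set X) := isClosed_singleton_of_isClosed_redSub (Z₁ ∪ Z₂) h₁₂ z hz
  have hx : x ∈ Z₁ ∪ Z₂ := by
    have h : x ∈ Set.range (redSubι X (Z₁ ∪ Z₂) h₁₂) := Set.mem_range_self z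
    rwa [range_subschemeι_vanishingIdeal] at h
  -- `𝓘(Z₁ ∪ Z₂) = 𝓘(Z₁) · 𝓘(Z₂)`
  have hsup : (⟨Z₁ ∪ Z₂, h₁₂⟩ : Closeds X) = (⟨Z₁, h₁⟩ : Closeds X) ⊔ ⟨Z₂, h₂⟩ := Closeds.ext (by simp [Closeds.coe_sup])
  have hI : vanishingIdeal (⟨Z₁ ∪ Z₂, h₁₂⟩ : Closeds X) = vanishingIdeal (⟨Z₁, h₁⟩ : Closeds X) * vanishingIdeal (⟨Z₂, h₂⟩ : Closeds X) := by
    rw [hsup]; exact vanishingIdeal_sup_eq_mul_of_disjoint (Z₁ := ⟨Z₁, h₁⟩) (Z₂ := ⟨Z₂, h₂⟩) hd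
  rw [ringKrullDim_stalk_redSub_eq_quotient, ← hxdef]
  have hstalk : stalkIdeal (vanishingIdeal (⟨Z₁ ∪ Z₂, h₁₂⟩ : Closeds X)) x =
      stalkIdeal (vanishingIdeal (⟨Z₁, h₁⟩ : Closeds X)) x * stalkIdeal (vanishingIdeal (⟨Z₂, h₂⟩ : Closeds X)) x := by
    rw [hI, stalkIdeal_mul]
  rcases hx with hx₁ | hx₂
  · -- over `Z₁`: `𝓘(Z₂)_x = ⊤`
    have hx₂ : x ∉ (vanishingIdeal (⟨Z₂, h₂⟩ : Closeds X)).support := by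
      rw [← SetLike.mem_coe, Scheme.IdealSheafData.coe_support_vanishingIdeal]
      exact fun h => hd.le_bot ⟨hx₁, h⟩
    rw [stalkIdeal_eq_top_of_not_mem_support hx₂, Ideal.mul_top] at hstalk
    rw [hstalk]
    -- the point of `Z̃₁` over `x`
    have hx₁' : x ∈ Set.range (redSubι X Z₁ h₁) := by rw [range_subschemeι_vanishingIdeal]; exact hx₁
    obtain ⟨z₁, hz₁⟩ := hx₁'
    have hz₁cl : IsClosed ({z₁} : Set ↥(redSub X Z₁ h₁)) := isClosed_singleton_redSub_of_isClosed Z₁ h₁ z₁ (by rw [hz₁]; exact hxcl)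
    rw [← hd₁ z₁ hz₁cl, ringKrullDim_stalk_redSub_eq_quotient, hz₁]
  · -- over `Z₂`: `𝓘(Z₁)_x = ⊤`
    have hx₁ : x ∉ (vanishingIdeal (⟨Z₁, h₁⟩ : Closeds X)).support := by
      rw [← SetLike.mem_coe, Scheme.IdealSheafData.coe_support_vanishingIdeal]
      exact fun h => hd.le_bot ⟨h, hx₂⟩
    rw [stalkIdeal_eq_top_of_not_mem_support hx₁, Ideal.top_mul] at hstalk
    rw [hstalk]
    have hx₂' : x ∈ Set.range (redSubι X Z₂ h₂) := by rw [range_subschemeι_vanishingIdeal]; exact hx₂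
    obtain ⟨z₂, hz₂⟩ := hx₂'
    have hz₂cl : IsClosed ({z₂} : Set ↥(redSub X Z₂ h₂)) := isClosed_singleton_redSub_of_isClosed Z₂ h₂ z₂ (by rw [hz₂]; exact hxcl)
    rw [← hd₂ z₂ hz₂cl, ringKrullDim_stalk_redSub_eq_quotient, hz₂]

/-- **The curve clause for a disjoint union of two curves on a surface `H ⊂ ℙ³_k`** (res-L1-w45b-nose-w3's gap (a) for reducible noses such as two skew
double lines): for `ι : H ↪ ℙ³_k` a closed immersion of an integral non-regular scheme and `Z₁, Z₂ ⊆ ι(H)` disjoint, closed, irreducible, infinite, with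
`ι(H) ⊄ Zᵢ`, the reduced subscheme of `Z₁ ∪ Z₂` has `dim 𝒪 = 1` at every closed point. [folklore] -/
theorem ringKrullDim_stalk_redSub_union_eq_one_three (k : Type) [Field k] (H : Scheme.{0}) (ι : H ⟶ (projectiveSpace 3 k).left)
    [IsClosedImmersion ι] [IsIntegral H] (hH : ¬ Literature.AlgebraicGeometry.Resolution.Scheme.IsRegular H)
    {Z₁ Z₂ : Set (projectiveSpace 3 k).left} (h₁ : IsClosed Z₁) (h₂ : IsClosed Z₂) (hirr₁ : IsIrreducible Z₁) (hirr₂ : IsIrreducible Z₂)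
    (hinf₁ : Z₁.Infinite) (hinf₂ : Z₂.Infinite) (hsub₁ : Z₁ ⊆ Set.range ι) (hsub₂ : Z₂ ⊆ Set.range ι)
    (hne₁ : ¬ (Set.range ι ⊆ Z₁)) (hne₂ : ¬ (Set.range ι ⊆ Z₂)) (hdisj : Z₁ ∩ Z₂ = ∅) (h₁₂ : IsClosed (Z₁ ∪ Z₂)) :
    ∀ z : ↥(redSub (projectiveSpace 3 k).left (Z₁ ∪ Z₂) h₁₂), IsClosed ({z} : Set ↥(redSub (projectiveSpace 3 k).left (Z₁ ∪ Z₂) h₁₂)) →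
      ringKrullDim ((redSub (projectiveSpace 3 k).left (Z₁ ∪ Z₂) h₁₂).presheaf.stalk z) = ((1 : ℕ) : WithBot ℕ∞) :=
  ringKrullDim_stalk_redSub_union_of_disjoint h₁ h₂ hdisj h₁₂
    (ringKrullDim_stalk_redSub_eq_one k H ι hH h₁ hirr₁ hinf₁ hsub₁ hne₁)
    (ringKrullDim_stalk_redSub_eq_one k H ι hH h₂ hirr₂ hinf₂ hsub₂ hne₂)

end Summit.ResolutionOfSingularities.ResolutionOfSingularities.Cruxes.EquisingularLiftNat.Sections

end
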